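import Mathlib
import Summits.CriticalPhenomena.SAWScalingLimit.Statement
import Literature.Probability.RandomPlanarGeometry.DiagonalDressedSAW
import HarnessLib

/-!
# Birth skeleton (BC3) of piece `WindowRigidity` of the split of `DiagonalUniversality`
(route `SAWDeterminantalDiagonal`, crux stmt-CriticalPhenomena-8247; crux-strategist BC2 redirect)

`WindowRigidity` is one of the three children CriticalCurve / WindowRigidity / ScoreDecoupling (statements in
`Cruxes/DiagonalUniversality/Split/SPLIT.md`; objects in
`Literature/Probability/RandomPlanarGeometry/DiagonalDressedSAW.lean`). Until the route split is applied
the piece is a LOCAL def here with the child's statement verbatim; afterwards replace `WindowRigidity` below by the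
route decl `Summit.CriticalPhenomena.SAWScalingLimit.Theses.SAWDeterminantalDiagonal.WindowRigidity` (same term).
Two named stubs (`sorry`, genuine lemmas of the line) and the kernel-checked composition `WindowRigidity_of`.
Checked: lean check rc 0, sorries = 2 = stubs; per-stub probes stub → WindowRigidity and stub → SAWScalingLimit
FAIL (bc/PROBES.md in the strategist folder, reproduced in SPLIT.md).
-/

noncomputable section

namespace Summit.CriticalPhenomena.SAWScalingLimit.Cruxes.DiagonalUniversality.Birth

open MeasureTheory Filter Topology Set
open scoped NNReal ENNReal BoundedContinuousFunction
open Literature.Probability.RandomPlanarGeometry Literature.Probability.LatticeModels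

namespace WindowRigidityBirth

/-- The child `WindowRigidity` of the split of `DiagonalUniversality` (verbatim statement of the route item to be). -/
def WindowRigidity : Prop :=
  ∀ x : ℝ, 0 < x → Literature.Probability.RandomPlanarGeometry.SAW.DiscrepancyConvergesToSLE x → ∀ y : ℝ, 0 < y → Literature.Probability.RandomPlanarGeometry.SAW.InDiagonalWindow (1 / 2) y → y = x

/-! ## Birth skeleton of piece `WindowRigidity`
(= `∀ x > 0, SAW.DiscrepancyConvergesToSLE x → ∀ y > 0, SAW.InDiagonalWindow (1/2) y → y = x`)

Two stubs: an SLE_{8/3} limit forces the window (non-ballistic: lower semicontinuity of length under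
convergence modulo reparametrisation; non-dense: the `ρ`-sausage of the SLE_{8/3} range has area
`→ 0`), and uniqueness of the window fugacity at `s = 1/2` (monotonicity of `|γ|` in the fugacity +
sharpness of the transition of the discrepancy walk). -/

/-- Stub 1 — **an SLE_{8/3} limit of the discrepancy walk forces the criticality window at its
fugacity**: `P(δ|γ| ≤ K) → 0` (a curve converging to a fractal curve has diverging lattice length)
and `P(δ²|γ| ≥ ε) → 0` (the walk stays in a vanishing-area neighbourhood of a Lebesgue-null limit
range). -/
theorem stub_window_of_convergesToSLE :
    ∀ x : ℝ, 0 < x → SAW.DiscrepancyConvergesToSLE x → SAW.InDiagonalWindow (1 / 2) x := by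
  sorry

/-- Stub 2 — **the window fugacity of the discrepancy walk is unique** (no critical interval at
`s = 1/2`: two window-critical positive fugacities coincide). -/
theorem stub_window_unique :
    ∀ y₁ y₂ : ℝ, 0 < y₁ → 0 < y₂ →
      SAW.InDiagonalWindow (1 / 2) y₁ → SAW.InDiagonalWindow (1 / 2) y₂ → y₁ = y₂ := by
  sorry

/-- Composition: rigidity of the window at the discrepancy end. -/
theorem WindowRigidity_of :
    (∀ x : ℝ, 0 < x → SAW.DiscrepancyConvergesToSLE x → SAW.InDiagonalWindow (1 / 2) x) →
    (∀ y₁ y₂ : ℝ, 0 < y₁ → 0 < y₂ →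
      SAW.InDiagonalWindow (1 / 2) y₁ → SAW.InDiagonalWindow (1 / 2) y₂ → y₁ = y₂) →
    WindowRigidity := by
  intro h1 h2 x hx hDW y hy hw
  exact h2 y x hy hx hw (h1 x hx hDW)

end WindowRigidityBirth

end Summit.CriticalPhenomena.SAWScalingLimit.Cruxes.DiagonalUniversality.Birth
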